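import Summits.QuantumFields.BalabanUV.Beta.MultiscaleGradientCoercive
import Summits.QuantumFields.BalabanUV.Beta.MultiscaleGradientSource

/-!
# `Summit.QuantumFields.BalabanUV.Beta.MultiscaleGradientCommutator` — engine file 20b: the binder-free pieces of the ℓ² GRADIENT
# member's assembly — (§1) a functional dominated by the conjugated pairing is dominated by the weighted source mass; (§2) the
# COMMUTATOR of the covariant derivative with the conjugation `e^{φ}` bondwise, for every isometric bond matrix; (§3) its sum over a
# bond set of the torus (`slen(b) ≤ n(b₊)⁻¹`, at most `d` bonds per target)

HONEST FRAMING (page 1 of everything in this cell).  Discharging `FlowStep.BetaPertH` would make Bałaban's ultraviolet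
stability UNCONDITIONAL — a constructive-QFT result; it is NOT the continuum limit and NOT the Clay problem.  This module
discharges nothing of `BetaPertH`; it is [folklore] finite-dimensional bookkeeping about the MODEL operator, kernel-checked, by the
OWNER of binder row D4 (unit `b2b-balaban-beta-an4`, gen 46).  HONEST DEPENDENCY: continuum YM on T⁴ ⇐ BetaPertH ∧ nine spine
estimates (0/9 proved); BetaPertH ⇐ (D1) ∧ (D4) ∧ CAP+tail; G-an2-4 gates asym, D1 and NE2/3/4.

THE POINT (O.2 item (i), the ℓ² gradient member (3.46)₂ at MODEL level; NOT the critical path).  File 20c `MultiscaleGradientL2`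
proves `‖1_{b₋ ∈ cell k}D(levelOp)⁻¹u‖₂ ≲ n_{k′}e^{−κd_n(t_k,t_{k′})}‖u‖₂` for EVERY isometric transport from file 20a's conjugated
coercivity with the Dirichlet term (`hgrad_levelOp`).  The three ingredients that do not mention `levelOp`'s inverse live here:
§1 `functional_le_of_pairing` — under the profile hypothesis `Σμv² ≤ ⟨e^{κρ}v, A(e^{−κρ}v)⟩` of `MultiscaleCombesThomasL2Real`, any
functional `Φ ≤ pairing` has `Φ(e^{κρ}A⁻¹u) ≤ Σμ⁻¹(e^{κρ}u)²` (termwise AM–GM + `real_weighted_solution_bound`); §2 `covD_expW` — the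
exact identity `(D e^{φ}w)(b,i) = e^{φ(b₋)}(Dw)(b,i) + c_b(e^{φ(b₊)} − e^{φ(b₋)})(R_b w(b₊))_i` — and `sum_sq_exp_covD_le` —
`Σ_i e^{2φ(b₋)}(Dw)(b,i)² ≤ 2Σ_i(D e^{φ}w)(b,i)² + 2c_b²(eθ_b)²‖(e^{φ}w)(b₊)‖²` for `|φ(b₊) − φ(b₋)| ≤ θ_b ≤ 1` and `R_b` with
orthonormal columns (`isometry_sq_sum`); §3 `bond_sum_commutator_le` — summed over any bond set with `θ_b = κ·slen(b)`:
`Σ_{b∈Bd}Σ_i e^{2φ(b₋)}(Dw)² ≤ 2‖D(e^{φ}w)‖² + 2c_max²e²κ²·d·Σ_x n(x)⁻²‖(e^{φ}w)(x)‖²`.  WHAT THIS IS NOT: nothing of Bałaban's ∇_UG′(U);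
(3.3)∕(3.46) are LOCATORS; row D4 readiness width 0; D4 DISCHARGE NO DATE.

WHAT IS CERTIFIED (kernel, 0 sorry, 0 def): `functional_le_of_pairing`, `covD_expW`, `sum_sq_exp_covD_le`, `bond_sum_commutator_le`.  LOCATORS (shape only; ABSOLUTE RULE — nothing printed is asserted): [Balaban1985BackgroundPropagators]
(3.3) pp. 390–391, Thm 3.1 (3.46) p. 398; [Balaban1984PropagatorsII] (2.46) p. 231.  NOT BetaPertH, NOT continuum, NOT Clay.
-/

open scoped BigOperators
open Finset

namespace Summit.QuantumFields.BalabanUV.Beta.MultiscaleGradientCommutator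

open Summit.QuantumFields.BalabanUV.Beta.BoxPoincare (Box)
open Summit.QuantumFields.BalabanUV.Beta.MultiscaleCoerciveTorus
open Summit.QuantumFields.BalabanUV.Beta.MultiscaleConjError (siteSq siteSq_nonneg)
open Summit.QuantumFields.BalabanUV.Beta.MultiscaleDistance
open Summit.QuantumFields.BalabanUV.Beta.MultiscaleDecayBudget
open Summit.QuantumFields.BalabanUV.Beta.MultiscaleDecay (hc_levelOp decay_levelOp)
open Summit.QuantumFields.BalabanUV.Beta.MultiscaleGradientCoercive (hgrad_levelOp)
open Summit.QuantumFields.BalabanUV.Beta.MultiscaleCombesThomasL2Real (real_weighted_solution_bound)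
open Summit.QuantumFields.BalabanUV.Beta.MultiscaleAveragingPointwise (isometry_sq_sum)
open Summit.QuantumFields.BalabanUV.Beta.AccretiveCombesThomasSandwichSite (sdist_corner_thresholds)
open Literature.MathematicalPhysics.QuantumFieldTheory.Balaban1983to89
open Literature.MathematicalPhysics.QuantumFieldTheory.Balaban1983to89.B9Thm37Glue (covD covD_apply)
open Literature.MathematicalPhysics.QuantumFieldTheory.Balaban1983to89.B9Thm37GluePU (bsrc btgt bsrc_apply btgt_apply)
open Literature.MathematicalPhysics.QuantumFieldTheory.Balaban1983to89.B9Thm37GlueTorusCov (tblk)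
open Literature.MathematicalPhysics.QuantumFieldTheory.Balaban1983to89.B9Thm37GlueTorusCovLevels (levelOp)
open Literature.MathematicalPhysics.QuantumFieldTheory.Balaban1983to89.B9Thm37GlueTorusCovCT (expW expW_apply
  sum_comp_le_of_card_fiber_le card_filter_btgt_le)
open B5TorusCover (UT Ctr ctrU)

noncomputable section

/-! ## §1 Abstract: a functional dominated by the conjugated pairing -/

/-- **A FUNCTIONAL DOMINATED BY THE CONJUGATED PAIRING IS DOMINATED BY THE WEIGHTED SOURCE MASS.**  Real endomorphism `A` of
`Y → ℝ` with the profile hypothesis `Σ_p μ_p v_p² ≤ ⟨e^{κρ}v, A(e^{−κρ}v)⟩` (`μ > 0`) and a functional `Φ` with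
`Φ(v) ≤ ⟨e^{κρ}v, A(e^{−κρ}v)⟩` for all `v`; if `Aw = u` then `Φ(e^{κρ}w) ≤ Σ_p μ_p⁻¹(e^{κρ_p}u_p)²` (the pairing at `v = e^{κρ}w` is
`Σ e^{κρ}v·u ≤ ½(Σμv² + Σμ⁻¹(e^{κρ}u)²)` by AM–GM, and `Σμv² ≤ Σμ⁻¹(e^{κρ}u)²` by `real_weighted_solution_bound`). [folklore] -/
theorem functional_le_of_pairing {Y : Type*} [Fintype Y] {A : Module.End ℝ (Y → ℝ)} {κ : ℝ} {ρ : Y → ℝ} {μ : Y → ℝ}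
    (hμ : ∀ p, 0 < μ p)
    (hc : ∀ v : Y → ℝ, ∑ p, μ p * v p ^ 2 ≤ ∑ p, Real.exp (κ * ρ p) * v p * A (fun q => Real.exp (-(κ * ρ q)) * v q) p)
    (Φ : (Y → ℝ) → ℝ)
    (hΦ : ∀ v : Y → ℝ, Φ v ≤ ∑ p, Real.exp (κ * ρ p) * v p * A (fun q => Real.exp (-(κ * ρ q)) * v q) p)
    {w u : Y → ℝ} (hw : A w = u) :
    Φ (fun p => Real.exp (κ * ρ p) * w p) ≤ ∑ p, (μ p)⁻¹ * (Real.exp (κ * ρ p) * u p) ^ 2 := by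
  set v : Y → ℝ := fun p => Real.exp (κ * ρ p) * w p with hvdef
  have hback : (fun q => Real.exp (-(κ * ρ q)) * v q) = w := by
    funext q
    rw [hvdef]
    simp only
    rw [← mul_assoc, ← Real.exp_add, show -(κ * ρ q) + κ * ρ q = 0 by ring, Real.exp_zero, one_mul]
  have hP := real_weighted_solution_bound hμ hc hw
  have h := hΦ v
  rw [hback, hw] at h
  -- AM–GM termwise: `e^{κρ}v·u ≤ ½(μv² + μ⁻¹(e^{κρ}u)²)`
  have hag : ∑ p, Real.exp (κ * ρ p) * v p * u p ≤
      ∑ p, (μ p * v p ^ 2 + (μ p)⁻¹ * (Real.exp (κ * ρ p) * u p) ^ 2) / 2 := by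
    refine Finset.sum_le_sum fun p _ => ?_
    have hμp := hμ p
    have key : 0 ≤ (μ p * v p - Real.exp (κ * ρ p) * u p) ^ 2 := sq_nonneg _
    have e : (μ p * v p - Real.exp (κ * ρ p) * u p) ^ 2 =
        μ p * (μ p * v p ^ 2 + (μ p)⁻¹ * (Real.exp (κ * ρ p) * u p) ^ 2 - 2 * (Real.exp (κ * ρ p) * v p * u p)) := by
      field_simp
      ring
    rw [e] at key
    have := (mul_nonneg_iff_of_pos_left hμp).mp key
    linarith
  have hsum : ∑ p, (μ p * v p ^ 2 + (μ p)⁻¹ * (Real.exp (κ * ρ p) * u p) ^ 2) / 2 =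
      (∑ p, μ p * v p ^ 2 + ∑ p, (μ p)⁻¹ * (Real.exp (κ * ρ p) * u p) ^ 2) / 2 := by
    rw [← Finset.sum_add_distrib, Finset.sum_div]
  rw [hsum] at hag
  have hPv : ∑ p, μ p * v p ^ 2 = ∑ p, μ p * (Real.exp (κ * ρ p) * w p) ^ 2 := by rw [hvdef]
  rw [hPv] at hag
  linarith

/-! ## §2 The commutator of the covariant derivative with the conjugation -/

section Commutator

variable {St Bd Cp : Type} [Fintype Cp] (src tgt : Bd → St) (c : Bd → ℝ) (Rm : Bd → Cp → Cp → ℝ)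

/-- **THE COMMUTATOR IDENTITY**: `(D e^{φ}w)(b,i) = e^{φ(b₋)}·(Dw)(b,i) + c_b·(e^{φ(b₊)} − e^{φ(b₋)})·Σ_j R_b(i,j)w(b₊,j)`.
[cite: Balaban1985BackgroundPropagators, (3.3) pp.390–391] [folklore] -/
theorem covD_expW (φ : St → ℝ) (w : St × Cp → ℝ) (b : Bd) (i : Cp) :
    covD src tgt c Rm (expW φ w) (b, i) =
      Real.exp (φ (src b)) * covD src tgt c Rm w (b, i) +
        c b * (Real.exp (φ (tgt b)) - Real.exp (φ (src b))) * ∑ j, Rm b i j * w (tgt b, j) := by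
  rw [covD_apply, covD_apply]
  simp only [expW]
  have h : ∑ j, Rm b i j * (Real.exp (φ (tgt b)) * w (tgt b, j)) = Real.exp (φ (tgt b)) * ∑ j, Rm b i j * w (tgt b, j) := by
    rw [Finset.mul_sum]
    exact Finset.sum_congr rfl fun j _ => by ring
  rw [h]
  ring

variable [DecidableEq Cp]

/-- **THE SQUARE BOUND OF THE COMMUTATOR, SUMMED OVER THE FIBRE.**  For an isometric `R_b` (columns orthonormal) and
`|φ(b₊) − φ(b₋)| ≤ θ_b` with `0 ≤ θ_b ≤ 1`:
`Σ_i e^{2φ(b₋)}(Dw)(b,i)² ≤ 2Σ_i (D e^{φ}w)(b,i)² + 2c_b²(e·θ_b)²·Σ_j (e^{φ}w)(b₊,j)²` (`|1 − e^{φ(b₋)−φ(b₊)}| ≤ e^{θ_b} − 1 ≤ e·θ_b`).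
[folklore] -/
theorem sum_sq_exp_covD_le (hRmb : ∀ b i j, ∑ k, Rm b k i * Rm b k j = if i = j then (1 : ℝ) else 0) (φ : St → ℝ)
    (w : St × Cp → ℝ) (b : Bd) {θ : ℝ} (hθ0 : 0 ≤ θ) (hθ1 : θ ≤ 1) (hφ : |φ (tgt b) - φ (src b)| ≤ θ) :
    ∑ i, (Real.exp (φ (src b)) * covD src tgt c Rm w (b, i)) ^ 2 ≤
      2 * ∑ i, (covD src tgt c Rm (expW φ w) (b, i)) ^ 2 +
        2 * (c b ^ 2 * (Real.exp 1 * θ) ^ 2 * ∑ j, (expW φ w (tgt b, j)) ^ 2) := by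
  have hsq2 : ∀ x y : ℝ, (x + y) ^ 2 ≤ 2 * x ^ 2 + 2 * y ^ 2 := fun x y => by nlinarith [sq_nonneg (x - y)]
  -- the scalar `1 − e^{φ(b₋) − φ(b₊)}`
  set δ : ℝ := 1 - Real.exp (φ (src b) - φ (tgt b)) with hδ
  have hδabs : |δ| ≤ Real.exp 1 * θ := by
    -- `|1 − e^{x}| ≤ e^{|x|} − 1 ≤ |x|·e^{|x|} ≤ θ·e`
    set x : ℝ := φ (src b) - φ (tgt b) with hx
    have hxθ : |x| ≤ θ := by rw [hx, abs_sub_comm]; exact hφ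
    have h1 : |1 - Real.exp x| ≤ Real.exp |x| - 1 := by
      rw [abs_sub_le_iff]
      constructor
      · -- `1 − e^x ≤ e^{|x|} − 1`: since `e^x ≥ e^{−|x|} ≥ 2 − e^{|x|}`
        have hx' : -|x| ≤ x := neg_abs_le x
        have h2 : Real.exp (-|x|) ≤ Real.exp x := Real.exp_le_exp.mpr hx'
        have h3 : Real.exp (-|x|) * Real.exp |x| = 1 := by rw [← Real.exp_add]; simp
        have h4 : 0 < Real.exp |x| := Real.exp_pos _
        nlinarith [Real.add_one_le_exp (|x|), Real.add_one_le_exp (-|x|), abs_nonneg x]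
      · have : Real.exp x ≤ Real.exp |x| := Real.exp_le_exp.mpr (le_abs_self x)
        linarith
    have h2 : Real.exp |x| - 1 ≤ |x| * Real.exp |x| := by
      -- `e^t − 1 ≤ t e^t` for `t ≥ 0`: from `1 ≥ e^{-t}(1) ... ` use `add_one_le_exp (-t)`
      have ht := abs_nonneg x
      have h := Real.add_one_le_exp (-|x|)
      have hpos : 0 < Real.exp |x| := Real.exp_pos _
      have h3 : Real.exp (-|x|) * Real.exp |x| = 1 := by rw [← Real.exp_add]; simp
      nlinarith
    have h3 : |x| * Real.exp |x| ≤ θ * Real.exp 1 :=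
      mul_le_mul hxθ (Real.exp_le_exp.mpr (hxθ.trans hθ1)) (Real.exp_pos _).le hθ0
    calc |δ| = |1 - Real.exp x| := by rw [hδ]
      _ ≤ θ * Real.exp 1 := (h1.trans h2).trans h3
      _ = Real.exp 1 * θ := mul_comm _ _
  -- bondwise identity: `e^{φ(b₋)}(Dw)(b,i) = (D e^φ w)(b,i) − c_b δ e^{φ(b₊)} Σ_j R w(b₊)` written with `expW`
  have hid : ∀ i, Real.exp (φ (src b)) * covD src tgt c Rm w (b, i) =
      covD src tgt c Rm (expW φ w) (b, i) + (-(c b * δ * ∑ j, Rm b i j * expW φ w (tgt b, j))) := by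
    intro i
    rw [covD_expW src tgt c Rm φ w b i, hδ]
    simp only [expW]
    have h : ∑ j, Rm b i j * (Real.exp (φ (tgt b)) * w (tgt b, j)) = Real.exp (φ (tgt b)) * ∑ j, Rm b i j * w (tgt b, j) := by
      rw [Finset.mul_sum]; exact Finset.sum_congr rfl fun j _ => by ring
    rw [h]
    have e1 : Real.exp (φ (src b) - φ (tgt b)) * Real.exp (φ (tgt b)) = Real.exp (φ (src b)) := by
      rw [← Real.exp_add]; ring_nf
    have : c b * (1 - Real.exp (φ (src b) - φ (tgt b))) * (Real.exp (φ (tgt b)) * ∑ j, Rm b i j * w (tgt b, j)) =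
        c b * (Real.exp (φ (tgt b)) - Real.exp (φ (src b))) * ∑ j, Rm b i j * w (tgt b, j) := by
      have : (1 - Real.exp (φ (src b) - φ (tgt b))) * Real.exp (φ (tgt b)) = Real.exp (φ (tgt b)) - Real.exp (φ (src b)) := by
        rw [sub_mul, one_mul, e1]
      calc c b * (1 - Real.exp (φ (src b) - φ (tgt b))) * (Real.exp (φ (tgt b)) * ∑ j, Rm b i j * w (tgt b, j))
          = c b * ((1 - Real.exp (φ (src b) - φ (tgt b))) * Real.exp (φ (tgt b))) * ∑ j, Rm b i j * w (tgt b, j) := by ring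
        _ = _ := by rw [this]
    rw [this]
    ring
  -- square, sum over the fibre, and the isometry `Σ_i (Σ_j R_{ij} g_j)² = Σ_j g_j²`
  have hiso : ∑ i, (∑ j, Rm b i j * expW φ w (tgt b, j)) ^ 2 = ∑ j, (expW φ w (tgt b, j)) ^ 2 :=
    isometry_sq_sum (Rm b) (hRmb b) (fun j => expW φ w (tgt b, j))
  calc ∑ i, (Real.exp (φ (src b)) * covD src tgt c Rm w (b, i)) ^ 2
      = ∑ i, (covD src tgt c Rm (expW φ w) (b, i) + (-(c b * δ * ∑ j, Rm b i j * expW φ w (tgt b, j)))) ^ 2 :=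
        Finset.sum_congr rfl fun i _ => by rw [hid i]
    _ ≤ ∑ i, (2 * (covD src tgt c Rm (expW φ w) (b, i)) ^ 2 + 2 * (-(c b * δ * ∑ j, Rm b i j * expW φ w (tgt b, j))) ^ 2) :=
        Finset.sum_le_sum fun i _ => hsq2 _ _
    _ = 2 * ∑ i, (covD src tgt c Rm (expW φ w) (b, i)) ^ 2 +
          2 * ((c b * δ) ^ 2 * ∑ i, (∑ j, Rm b i j * expW φ w (tgt b, j)) ^ 2) := by
        rw [Finset.sum_add_distrib, ← Finset.mul_sum, ← Finset.mul_sum, Finset.mul_sum (s := univ) (f := fun i =>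
          (∑ j, Rm b i j * expW φ w (tgt b, j)) ^ 2)]
        congr 1
        congr 1
        exact Finset.sum_congr rfl fun i _ => by ring
    _ = 2 * ∑ i, (covD src tgt c Rm (expW φ w) (b, i)) ^ 2 + 2 * (c b ^ 2 * δ ^ 2 * ∑ j, (expW φ w (tgt b, j)) ^ 2) := by
        rw [hiso]; ring
    _ ≤ 2 * ∑ i, (covD src tgt c Rm (expW φ w) (b, i)) ^ 2 +
          2 * (c b ^ 2 * (Real.exp 1 * θ) ^ 2 * ∑ j, (expW φ w (tgt b, j)) ^ 2) := by
        have hδ2 : δ ^ 2 ≤ (Real.exp 1 * θ) ^ 2 := by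
          rw [← sq_abs δ]; exact pow_le_pow_left₀ (abs_nonneg _) hδabs 2
        have hS : 0 ≤ ∑ j, (expW φ w (tgt b, j)) ^ 2 := Finset.sum_nonneg fun j _ => sq_nonneg _
        have := mul_le_mul_of_nonneg_left (mul_le_mul_of_nonneg_right hδ2 hS) (sq_nonneg (c b))
        nlinarith [this]

end Commutator

/-! ## §3 The commutator summed over a bond set on the torus (at most `d` bonds per target) -/

section BondSum

variable {d : ℕ} {N : Fin d → ℕ} [∀ i, NeZero (N i)] [NeZero d] {Cp J K : Type} [Fintype Cp] [DecidableEq Cp]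
  [Fintype J] [Fintype K] [DecidableEq K] (S : J → ℕ) (hS : ∀ l, 1 ≤ S l) (hdivS : ∀ l i, S l ∣ N i) (lvl : K → J)
  (zc : (k : K) → Ctr N (S (lvl k)))
  (hcover : ∀ x : UT N, ∃ k, ∃ v : Box d (S (lvl k)), cellPt S hS hdivS lvl zc k v = x)
  (Rm : UT N × Fin d → Cp → Cp → ℝ) (hRm : ∀ b i j, ∑ k, Rm b k i * Rm b k j = if i = j then (1 : ℝ) else 0)
  (c : UT N × Fin d → ℝ) {cmax : ℝ} (hc : ∀ b, |c b| ≤ cmax) {κ : ℝ} (hκ0 : 0 ≤ κ) (hκ1 : κ ≤ 1)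

include hRm hc hκ0 hκ1

omit [NeZero d] [Fintype J] [Fintype K] [DecidableEq K] in
/-- **THE COMMUTATOR SUMMED OVER A BOND SET.**  With `n` the site scale, a weight `φ` with `|φ(b₊) − φ(b₋)| ≤ κ·slen(b)` on every
bond (`0 ≤ κ ≤ 1`; e.g. `φ = κ·d_n(·,t)`), `g = e^{φ}w`, and ANY bond set `Bd`:
`Σ_{b∈Bd}Σ_i e^{2φ(b₋)}(Dw)(b,i)² ≤ 2Σ_q (Dg)(q)² + 2c_max²e²κ²·d·Σ_x n(x)⁻²‖g(x)‖²` (§2 bondwise, `slen(b) ≤ n(b₊)⁻¹`, at most `d`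
bonds end at a site). [folklore] -/
theorem bond_sum_commutator_le (φ : UT N → ℝ)
    (hφ : ∀ b : UT N × Fin d, |φ (btgt b) - φ (bsrc b)| ≤ κ * slen (siteScale S hS hdivS lvl zc hcover) (bsrc b) (btgt b))
    (w : UT N × Cp → ℝ) (Bd : Finset (UT N × Fin d)) :
    ∑ b ∈ Bd, ∑ i, (Real.exp (φ (bsrc b)) * covD bsrc btgt c Rm w (b, i)) ^ 2 ≤
      2 * ∑ q, (covD bsrc btgt c Rm (expW φ w) q) ^ 2 +
        2 * (cmax ^ 2 * Real.exp 1 ^ 2 * κ ^ 2 *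
          (d * ∑ x, ((siteScale S hS hdivS lvl zc hcover x : ℝ) ^ 2)⁻¹ * siteSq (expW φ w) x)) := by
  classical
  set n := siteScale S hS hdivS lvl zc hcover with hn
  set g := expW φ w with hg
  have hd0 : (0 : ℝ) ≤ d := Nat.cast_nonneg _
  -- bondwise
  have hbondle : ∀ b : UT N × Fin d,
      ∑ i, (Real.exp (φ (bsrc b)) * covD bsrc btgt c Rm w (b, i)) ^ 2 ≤
        2 * ∑ i, (covD bsrc btgt c Rm g (b, i)) ^ 2 +
          2 * (cmax ^ 2 * Real.exp 1 ^ 2 * κ ^ 2 * ((((n (btgt b) : ℝ)) ^ 2)⁻¹ * siteSq g (btgt b))) := by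
    intro b
    have hθ0 : 0 ≤ κ * slen n (bsrc b) (btgt b) := mul_nonneg hκ0 (slen_nonneg n _ _)
    have hsl1 : slen n (bsrc b) (btgt b) ≤ 1 := slen_le_one n (one_le_siteScale S hS hdivS lvl zc hcover) _ _
    have hθ1 : κ * slen n (bsrc b) (btgt b) ≤ 1 := by
      calc κ * slen n (bsrc b) (btgt b) ≤ 1 * 1 := mul_le_mul hκ1 hsl1 (slen_nonneg n _ _) zero_le_one
        _ = 1 := one_mul 1
    have h := sum_sq_exp_covD_le bsrc btgt c Rm hRm φ w b hθ0 hθ1 (hφ b)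
    rw [← hg] at h
    refine h.trans (add_le_add le_rfl ?_)
    have hc2 : c b ^ 2 ≤ cmax ^ 2 := by rw [← sq_abs (c b)]; exact pow_le_pow_left₀ (abs_nonneg _) (hc b) 2
    have hsl : slen n (bsrc b) (btgt b) ≤ ((n (btgt b) : ℝ))⁻¹ := (slen_bond_le bsrc btgt n b).2
    have hsl2 : slen n (bsrc b) (btgt b) ^ 2 ≤ (((n (btgt b) : ℝ)) ^ 2)⁻¹ := by
      rw [← inv_pow]; exact pow_le_pow_left₀ (slen_nonneg n _ _) hsl 2
    have hsite : ∑ j, (g (btgt b, j)) ^ 2 = siteSq g (btgt b) := rfl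
    rw [hsite]
    have hss := siteSq_nonneg g (btgt b)
    have e1 : c b ^ 2 * (Real.exp 1 * (κ * slen n (bsrc b) (btgt b))) ^ 2 * siteSq g (btgt b) =
        c b ^ 2 * (Real.exp 1 ^ 2 * κ ^ 2 * (slen n (bsrc b) (btgt b) ^ 2 * siteSq g (btgt b))) := by ring
    have e2 : cmax ^ 2 * Real.exp 1 ^ 2 * κ ^ 2 * ((((n (btgt b) : ℝ)) ^ 2)⁻¹ * siteSq g (btgt b)) =
        cmax ^ 2 * (Real.exp 1 ^ 2 * κ ^ 2 * ((((n (btgt b) : ℝ)) ^ 2)⁻¹ * siteSq g (btgt b))) := by ring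
    rw [e1, e2]
    have hin : slen n (bsrc b) (btgt b) ^ 2 * siteSq g (btgt b) ≤ (((n (btgt b) : ℝ)) ^ 2)⁻¹ * siteSq g (btgt b) :=
      mul_le_mul_of_nonneg_right hsl2 hss
    have hmid : Real.exp 1 ^ 2 * κ ^ 2 * (slen n (bsrc b) (btgt b) ^ 2 * siteSq g (btgt b)) ≤
        Real.exp 1 ^ 2 * κ ^ 2 * ((((n (btgt b) : ℝ)) ^ 2)⁻¹ * siteSq g (btgt b)) :=
      mul_le_mul_of_nonneg_left hin (by positivity)
    have hpos : 0 ≤ Real.exp 1 ^ 2 * κ ^ 2 * (slen n (bsrc b) (btgt b) ^ 2 * siteSq g (btgt b)) := by positivity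
    linarith [mul_le_mul hc2 hmid hpos (sq_nonneg cmax)]
  -- sum over `Bd ⊆ univ` and count fibres of `btgt`
  have hsumD : ∑ b : UT N × Fin d, ∑ i, (covD bsrc btgt c Rm g (b, i)) ^ 2 = ∑ q, (covD bsrc btgt c Rm g q) ^ 2 :=
    (Fintype.sum_prod_type (fun q : (UT N × Fin d) × Cp => (covD bsrc btgt c Rm g q) ^ 2)).symm
  have hfib : ∑ b : UT N × Fin d, ((n (btgt b) : ℝ) ^ 2)⁻¹ * siteSq g (btgt b) ≤ d * ∑ x, ((n x : ℝ) ^ 2)⁻¹ * siteSq g x :=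
    sum_comp_le_of_card_fiber_le btgt card_filter_btgt_le (fun x => ((n x : ℝ) ^ 2)⁻¹ * siteSq g x)
      fun x => mul_nonneg (inv_nonneg.mpr (sq_nonneg _)) (siteSq_nonneg g x)
  calc ∑ b ∈ Bd, ∑ i, (Real.exp (φ (bsrc b)) * covD bsrc btgt c Rm w (b, i)) ^ 2
      ≤ ∑ b, ∑ i, (Real.exp (φ (bsrc b)) * covD bsrc btgt c Rm w (b, i)) ^ 2 :=
        Finset.sum_le_sum_of_subset_of_nonneg (Finset.subset_univ Bd) fun b _ _ =>
          Finset.sum_nonneg fun i _ => sq_nonneg _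
    _ ≤ ∑ b, (2 * ∑ i, (covD bsrc btgt c Rm g (b, i)) ^ 2 +
          2 * (cmax ^ 2 * Real.exp 1 ^ 2 * κ ^ 2 * ((((n (btgt b) : ℝ)) ^ 2)⁻¹ * siteSq g (btgt b)))) :=
        Finset.sum_le_sum fun b _ => hbondle b
    _ = 2 * ∑ q, (covD bsrc btgt c Rm g q) ^ 2 +
          2 * (cmax ^ 2 * Real.exp 1 ^ 2 * κ ^ 2 * ∑ b : UT N × Fin d, ((n (btgt b) : ℝ) ^ 2)⁻¹ * siteSq g (btgt b)) := by
        rw [Finset.sum_add_distrib, ← Finset.mul_sum, hsumD, ← Finset.mul_sum, ← Finset.mul_sum]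
    _ ≤ 2 * ∑ q, (covD bsrc btgt c Rm g q) ^ 2 +
          2 * (cmax ^ 2 * Real.exp 1 ^ 2 * κ ^ 2 * (d * ∑ x, ((n x : ℝ) ^ 2)⁻¹ * siteSq g x)) := by
        have hcoef : 0 ≤ cmax ^ 2 * Real.exp 1 ^ 2 * κ ^ 2 := by positivity
        linarith [mul_le_mul_of_nonneg_left hfib hcoef]

end BondSum

end

end Summit.QuantumFields.BalabanUV.Beta.MultiscaleGradientCommutator
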